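import Mathlib

/-!
# No dissipative tower — the finite-dimensional calculus core (moment amplification)

Helper file for the crux `QuarticLadder.QuarticGate` (stmt-AnomalousDissipation-11464), line
`dissipative-tower`, stub T-core `stub_noTowerCalculus`. Pure Mathlib content on `ℝ^ι`:

* `exists_radial_bump_signs` — a compactly supported `C¹` bump `ρ ≥ 0` with `ρ c₀ = 1` and radial,
  inward gradient `∂_b ρ(c) = θ(c) c_b`, `θ ≤ 0` continuous and compactly supported.
* `integral_sum_mul_fderiv_eq_neg` — coordinatewise integration by parts, summed over coordinates.
* `eq_zero_of_tower` — the moment identity: a nonnegative `C¹` observable `G`, Euler-homogeneous of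
  degree `e` through `P`, with a `C¹` tower partner `Q` (`∇Q·V = ∇G·(Dc)`) for a divergence-free
  drift `V` tangent to spheres and `κ⟨Pc,c⟩ ≤ ⟨c,-Dc⟩`, vanishes identically as soon as
  `κ (e + tr P) + tr D > 0`.
* `stub_noTowerCalculus` — the registered statement: apply the above to `G = h^{2m+2}`,
  `Q = (2m+2) h^{2m+1} q`, `e = (2m+2) d` with `m` large.
-/

namespace Summit.AnomalousDissipation.AnomalousDissipation.Theorems.QuarticLadderQuarticGate

open MeasureTheory

set_option linter.dupNamespace false

/-- **A radial decreasing `C¹` bump adapted to a point.** For `c₀ ∈ ℝ^ι` there is a compactly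
supported `C¹` function `ρ ≥ 0` with `ρ c₀ = 1` whose gradient is radial and points inward:
`∂_b ρ(c) = θ(c) c_b` with `θ ≤ 0` continuous and compactly supported
(`ρ(c) = ψ(|c₀|² + 1 − |c|²)`, `ψ = Real.smoothTransition`, `θ = -2ψ'(|c₀|² + 1 − |c|²)`).
[folklore] -/
theorem exists_radial_bump_signs {ι : Type*} [Fintype ι] [DecidableEq ι] (c₀ : ι → ℝ) :
    ∃ (ρ θ : (ι → ℝ) → ℝ), ContDiff ℝ 1 ρ ∧ HasCompactSupport ρ ∧ Continuous θ ∧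
      HasCompactSupport θ ∧ ρ c₀ = 1 ∧ (∀ c, 0 ≤ ρ c) ∧ (∀ c, θ c ≤ 0) ∧
      ∀ c b, fderiv ℝ ρ c (Pi.single b 1) = θ c * c b := by
  set R : ℝ := ∑ a, c₀ a * c₀ a with hR
  set σ : (ι → ℝ) → ℝ := fun c => ∑ a, c a * c a with hσ
  set σ' : (ι → ℝ) → ((ι → ℝ) →L[ℝ] ℝ) := fun c =>
    ∑ a, (c a • ContinuousLinearMap.proj (R := ℝ) (φ := fun _ : ι => ℝ) a +
      c a • ContinuousLinearMap.proj (R := ℝ) (φ := fun _ : ι => ℝ) a) with hσ'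
  have hσd : ∀ c, HasFDerivAt σ (σ' c) c := fun c =>
    HasFDerivAt.fun_sum fun a _ =>
      (hasFDerivAt_apply (𝕜 := ℝ) a c).mul (hasFDerivAt_apply (𝕜 := ℝ) a c)
  have hσC : ContDiff ℝ 1 σ :=
    ContDiff.sum fun a _ => (contDiff_apply ℝ ℝ a).mul (contDiff_apply ℝ ℝ a)
  have hσb : ∀ c b, σ' c (Pi.single b 1) = 2 * c b := by
    intro c b
    simp only [hσ', sum_apply, add_apply, smul_apply, ContinuousLinearMap.proj_apply,
      Pi.single_apply, smul_eq_mul, mul_ite, mul_one, mul_zero, ← two_mul]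
    rw [Finset.sum_ite_eq' Finset.univ b, if_pos (Finset.mem_univ b)]
  have hK : IsCompact {c : ι → ℝ | σ c ≤ R + 1} := by
    refine Metric.isCompact_of_isClosed_isBounded (isClosed_le hσC.continuous continuous_const) ?_
    refine (Metric.isBounded_iff_subset_closedBall 0).2 ⟨Real.sqrt (R + 1), fun c hc => ?_⟩
    rw [mem_closedBall_zero_iff, pi_norm_le_iff_of_nonneg (Real.sqrt_nonneg _)]
    intro b
    rw [Real.norm_eq_abs]
    refine Real.abs_le_sqrt ?_
    calc c b ^ 2 = c b * c b := sq _
      _ ≤ σ c := Finset.single_le_sum (f := fun a => c a * c a) (fun a _ => mul_self_nonneg _)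
          (Finset.mem_univ b)
      _ ≤ R + 1 := hc
  have hψ1 : ContDiff ℝ 1 Real.smoothTransition := Real.smoothTransition.contDiff (n := 1)
  refine ⟨fun c => Real.smoothTransition (R + 1 - σ c),
    fun c => -(2 * deriv Real.smoothTransition (R + 1 - σ c)), ?_, ?_, ?_, ?_, ?_, ?_, ?_, ?_⟩
  · exact Real.smoothTransition.contDiff.comp (contDiff_const.sub hσC)
  · refine HasCompactSupport.intro hK fun c hc => ?_
    simp only [Set.mem_setOf_eq, not_le] at hc
    exact Real.smoothTransition.zero_of_nonpos (by linarith)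
  · exact (continuous_const.mul
      (hψ1.continuous_deriv_one.comp (continuous_const.sub hσC.continuous))).neg
  · refine HasCompactSupport.intro hK fun c hc => ?_
    simp only [Set.mem_setOf_eq, not_le] at hc
    have h0 : Real.smoothTransition =ᶠ[nhds (R + 1 - σ c)] fun _ => (0 : ℝ) :=
      (eventually_lt_nhds (by linarith : R + 1 - σ c < 0)).mono
        fun y hy => Real.smoothTransition.zero_of_nonpos hy.le
    show -(2 * deriv Real.smoothTransition (R + 1 - σ c)) = 0
    rw [h0.deriv_eq, deriv_const, mul_zero, neg_zero]
  · change Real.smoothTransition (R + 1 - ∑ a, c₀ a * c₀ a) = 1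
    rw [← hR, add_sub_cancel_left]
    exact Real.smoothTransition.one_of_one_le le_rfl
  · exact fun c => Real.smoothTransition.nonneg _
  · intro c
    have := Real.smoothTransition.monotone.deriv_nonneg (x := R + 1 - σ c)
    linarith
  · intro c b
    have hST : HasDerivAt Real.smoothTransition
        (deriv Real.smoothTransition (R + 1 - σ c)) (R + 1 - σ c) :=
      (hψ1.differentiable one_ne_zero _).hasDerivAt
    have h1 := hST.comp_hasFDerivAt c ((hasFDerivAt_const (R + 1) c).sub (hσd c))
    have h : HasFDerivAt (fun c => Real.smoothTransition (R + 1 - σ c))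
        (deriv Real.smoothTransition (R + 1 - σ c) • ((0 : (ι → ℝ) →L[ℝ] ℝ) - σ' c)) c := h1
    rw [h.fderiv, smul_apply, sub_apply, zero_apply, hσb, smul_eq_mul]
    ring

/-- **Coordinatewise integration by parts, summed over the coordinates.** For `C¹` functions
`fₐ, gₐ` on `ℝ^ι` with every `fₐ` compactly supported,
`∫ ∑ₐ fₐ ∂ₐgₐ = -∫ ∑ₐ (∂ₐfₐ) gₐ` (Lebesgue measure). [folklore] -/
theorem integral_sum_mul_fderiv_eq_neg {ι : Type*} [Fintype ι] [DecidableEq ι]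
    {f g : ι → (ι → ℝ) → ℝ} (hf : ∀ a, ContDiff ℝ 1 (f a)) (hg : ∀ a, ContDiff ℝ 1 (g a))
    (hfs : ∀ a, HasCompactSupport (f a)) :
    ∫ c, ∑ a, f a c * fderiv ℝ (g a) c (Pi.single a 1) =
      -∫ c, ∑ a, fderiv ℝ (f a) c (Pi.single a 1) * g a c := by
  have hcd : ∀ {φ : (ι → ℝ) → ℝ}, ContDiff ℝ 1 φ → ∀ v, Continuous fun c => fderiv ℝ φ c v :=
    fun hφ v => (hφ.continuous_fderiv one_ne_zero).clm_apply continuous_const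
  have hi1 : ∀ a, Integrable (fun c => fderiv ℝ (f a) c (Pi.single a 1) * g a c) := fun a =>
    ((hcd (hf a) _).mul (hg a).continuous).integrable_of_hasCompactSupport
      ((hfs a).fderiv_apply ℝ (Pi.single a 1)).mul_right
  have hi2 : ∀ a, Integrable (fun c => f a c * fderiv ℝ (g a) c (Pi.single a 1)) := fun a =>
    ((hf a).continuous.mul (hcd (hg a) _)).integrable_of_hasCompactSupport (hfs a).mul_right
  rw [integral_finsetSum _ fun a _ => hi2 a, integral_finsetSum _ fun a _ => hi1 a,
    ← Finset.sum_neg_distrib]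
  refine Finset.sum_congr rfl fun a _ => ?_
  exact integral_mul_fderiv_eq_neg_fderiv_mul_of_integrable (hi1 a) (hi2 a)
    (((hf a).continuous.mul (hg a).continuous).integrable_of_hasCompactSupport (hfs a).mul_right)
    (fun c _ => (hf a).differentiable one_ne_zero c)
    (fun c _ => (hg a).differentiable one_ne_zero c)

/-- **The moment identity behind "no dissipative tower".** On `ℝ^ι` let `V` be a `C¹` drift,
divergence free and tangent to spheres, `D`, `P` matrices with `κ ∑ P a b cₐ c_b ≤ -∑ D a b cₐ c_b`,
`G ≥ 0` a `C¹` observable which is Euler-homogeneous of degree `e` through `P`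
(`∑ₐ (P c)ₐ ∂ₐG = e G`) and admits a `C¹` TOWER PARTNER `Q` (`∑ₐ ∂ₐQ Vₐ = ∑ₐ ∂ₐG (D c)ₐ`).
If `κ (e + tr P) + tr D > 0` then `G ≡ 0`: for a radial decreasing bump `w`, three integrations by
parts give `(-tr D) ∫ G w ≥ κ (e + tr P) ∫ G w`. [folklore-new] -/
theorem eq_zero_of_tower {ι : Type*} [Fintype ι] [DecidableEq ι]
    {G Q : (ι → ℝ) → ℝ} {V : ι → (ι → ℝ) → ℝ} {D P : ι → ι → ℝ} {κ e : ℝ}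
    (hG : ContDiff ℝ 1 G) (hQ : ContDiff ℝ 1 Q) (hV : ∀ a, ContDiff ℝ 1 (V a))
    (hdiv : ∀ c, ∑ a, fderiv ℝ (V a) c (Pi.single a 1) = 0)
    (htan : ∀ c : ι → ℝ, ∑ a, c a * V a c = 0)
    (hcoer : ∀ c : ι → ℝ, κ * ∑ a, ∑ b, P a b * c a * c b ≤ -∑ a, ∑ b, D a b * c a * c b)
    (hEuler : ∀ c : ι → ℝ, ∑ a, (∑ b, P a b * c b) * fderiv ℝ G c (Pi.single a 1) = e * G c)
    (htower : ∀ c : ι → ℝ, ∑ a, fderiv ℝ Q c (Pi.single a 1) * V a c =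
      ∑ a, fderiv ℝ G c (Pi.single a 1) * ∑ b, D a b * c b)
    (hnn : ∀ c, 0 ≤ G c) (hpos : 0 < κ * (e + ∑ a, P a a) + ∑ a, D a a) (c₀ : ι → ℝ) :
    G c₀ = 0 := by
  obtain ⟨w, θ, hwC, hws, hθc, hθs, hw0, hwnn, hθnp, hwd⟩ := exists_radial_bump_signs c₀
  -- linear rows `c ↦ (M c)ₐ`: smoothness and partial derivatives
  have hLC : ∀ (M : ι → ι → ℝ) (a : ι), ContDiff ℝ 1 fun c : ι → ℝ => ∑ b, M a b * c b :=
    fun M a => ContDiff.sum fun b _ => contDiff_const.mul (contDiff_apply ℝ ℝ b)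
  have hLd : ∀ (M : ι → ι → ℝ) (a a' : ι) (c : ι → ℝ),
      fderiv ℝ (fun c : ι → ℝ => ∑ b, M a b * c b) c (Pi.single a' 1) = M a a' := by
    intro M a a' c
    have hφ : HasFDerivAt (fun c : ι → ℝ => ∑ b, M a b * c b)
        (∑ b, M a b • ContinuousLinearMap.proj (R := ℝ) (φ := fun _ : ι => ℝ) b) c :=
      HasFDerivAt.fun_sum fun b _ => (hasFDerivAt_apply (𝕜 := ℝ) b c).const_mul (M a b)
    rw [hφ.fderiv, sum_apply]
    simp only [smul_apply, ContinuousLinearMap.proj_apply, Pi.single_apply, smul_eq_mul, mul_ite,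
      mul_one, mul_zero, Finset.sum_ite_eq', Finset.mem_univ, if_true]
  have inner : ∀ (M : ι → ι → ℝ) (c : ι → ℝ),
      ∑ a, ∑ b, M a b * c a * c b = ∑ a, c a * ∑ b, M a b * c b := fun M c =>
    Finset.sum_congr rfl fun a _ => by
      rw [Finset.mul_sum]
      exact Finset.sum_congr rfl fun b _ => by ring
  have hGd : ∀ c, DifferentiableAt ℝ G c := fun c => hG.differentiable one_ne_zero c
  have hQd : ∀ c, DifferentiableAt ℝ Q c := fun c => hQ.differentiable one_ne_zero c
  have hwdf : ∀ c, DifferentiableAt ℝ w c := fun c => hwC.differentiable one_ne_zero c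
  -- integrability of the three integrands that get split
  have hrowc : ∀ M : ι → ι → ℝ, Continuous fun c : ι → ℝ => ∑ a, c a * ∑ b, M a b * c b :=
    fun M => continuous_finsetSum _ fun a _ => (continuous_apply a).mul
      (continuous_finsetSum _ fun b _ => continuous_const.mul (continuous_apply b))
  have hint : ∀ M : ι → ι → ℝ,
      Integrable fun c : ι → ℝ => G c * θ c * ∑ a, c a * ∑ b, M a b * c b := fun M =>
    ((hG.continuous.mul hθc).mul (hrowc M)).integrable_of_hasCompactSupport
      (hθs.mul_left.mul_right)
  have iGw : Integrable fun c => G c * w c :=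
    (hG.continuous.mul hwC.continuous).integrable_of_hasCompactSupport hws.mul_left
  -- (a) integration by parts with `F = Q w` against `V`: `∫ w ∑ₐ ∂ₐG (Dc)ₐ = 0`
  have h1 : ∫ c, ∑ a, Q c * w c * fderiv ℝ (V a) c (Pi.single a 1) =
      -∫ c, ∑ a, fderiv ℝ (fun c => Q c * w c) c (Pi.single a 1) * V a c :=
    integral_sum_mul_fderiv_eq_neg (f := fun _ c => Q c * w c) (g := V)
      (fun _ => hQ.mul hwC) hV (fun _ => hws.mul_left)
  have dQw : ∀ (a : ι) (c : ι → ℝ), fderiv ℝ (fun c => Q c * w c) c (Pi.single a 1) =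
      Q c * (θ c * c a) + w c * fderiv ℝ Q c (Pi.single a 1) := by
    intro a c
    rw [fderiv_fun_mul (hQd c) (hwdf c), add_apply, smul_apply, smul_apply, hwd, smul_eq_mul,
      smul_eq_mul]
  have eL1 : ∀ c, ∑ a, Q c * w c * fderiv ℝ (V a) c (Pi.single a 1) = 0 := fun c => by
    rw [← Finset.mul_sum, hdiv c, mul_zero]
  have eR1 : ∀ c, ∑ a, (Q c * (θ c * c a) + w c * fderiv ℝ Q c (Pi.single a 1)) * V a c =
      w c * ∑ a, fderiv ℝ G c (Pi.single a 1) * ∑ b, D a b * c b := fun c => by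
    have : ∑ a, (Q c * (θ c * c a) + w c * fderiv ℝ Q c (Pi.single a 1)) * V a c =
        Q c * θ c * ∑ a, c a * V a c + w c * ∑ a, fderiv ℝ Q c (Pi.single a 1) * V a c := by
      rw [Finset.mul_sum, Finset.mul_sum, ← Finset.sum_add_distrib]
      exact Finset.sum_congr rfl fun a _ => by ring
    rw [this, htan c, htower c, mul_zero, zero_add]
  have hA : ∫ c, w c * ∑ a, fderiv ℝ G c (Pi.single a 1) * ∑ b, D a b * c b = 0 := by
    simp_rw [eL1, dQw, eR1, integral_zero] at h1
    linarith
  -- (b) integration by parts with `w (Dc)ₐ` against `G`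
  have h2 : ∫ c, ∑ a, (w c * ∑ b, D a b * c b) * fderiv ℝ G c (Pi.single a 1) =
      -∫ c, ∑ a, fderiv ℝ (fun c => w c * ∑ b, D a b * c b) c (Pi.single a 1) * G c :=
    integral_sum_mul_fderiv_eq_neg (f := fun a c => w c * ∑ b, D a b * c b) (g := fun _ => G)
      (fun a => hwC.mul (hLC D a)) (fun _ => hG) (fun _ => hws.mul_right)
  have dWD : ∀ (a : ι) (c : ι → ℝ),
      fderiv ℝ (fun c => w c * ∑ b, D a b * c b) c (Pi.single a 1) =
        w c * D a a + (∑ b, D a b * c b) * (θ c * c a) := by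
    intro a c
    rw [fderiv_fun_mul (hwdf c) ((hLC D a).differentiable one_ne_zero c), add_apply, smul_apply,
      smul_apply, hLd, hwd, smul_eq_mul, smul_eq_mul]
  have eL2 : ∀ c, ∑ a, (w c * ∑ b, D a b * c b) * fderiv ℝ G c (Pi.single a 1) =
      w c * ∑ a, fderiv ℝ G c (Pi.single a 1) * ∑ b, D a b * c b := fun c => by
    rw [Finset.mul_sum]
    exact Finset.sum_congr rfl fun a _ => by ring
  have eR2 : ∀ c, ∑ a, (w c * D a a + (∑ b, D a b * c b) * (θ c * c a)) * G c =
      G c * θ c * (∑ a, c a * ∑ b, D a b * c b) + (∑ a, D a a) * (G c * w c) := fun c => by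
    rw [Finset.mul_sum, Finset.sum_mul, ← Finset.sum_add_distrib]
    exact Finset.sum_congr rfl fun a _ => by ring
  have hB : (∫ c, G c * θ c * ∑ a, c a * ∑ b, D a b * c b) + (∑ a, D a a) * ∫ c, G c * w c = 0 := by
    simp_rw [eL2, dWD, eR2] at h2
    rw [hA, integral_add (hint D) (iGw.const_mul _), integral_const_mul] at h2
    linarith
  -- (c) integration by parts with `w` against `G (Pc)ₐ`
  have h3 : ∫ c, ∑ a, w c * fderiv ℝ (fun c => G c * ∑ b, P a b * c b) c (Pi.single a 1) =
      -∫ c, ∑ a, fderiv ℝ w c (Pi.single a 1) * (G c * ∑ b, P a b * c b) :=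
    integral_sum_mul_fderiv_eq_neg (f := fun _ => w) (g := fun a c => G c * ∑ b, P a b * c b)
      (fun _ => hwC) (fun a => hG.mul (hLC P a)) (fun _ => hws)
  have dGP : ∀ (a : ι) (c : ι → ℝ),
      fderiv ℝ (fun c => G c * ∑ b, P a b * c b) c (Pi.single a 1) =
        G c * P a a + (∑ b, P a b * c b) * fderiv ℝ G c (Pi.single a 1) := by
    intro a c
    rw [fderiv_fun_mul (hGd c) ((hLC P a).differentiable one_ne_zero c), add_apply, smul_apply,
      smul_apply, hLd, smul_eq_mul, smul_eq_mul]
  have eL3 : ∀ c, ∑ a, w c * (G c * P a a + (∑ b, P a b * c b) * fderiv ℝ G c (Pi.single a 1)) =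
      (e + ∑ a, P a a) * (G c * w c) := fun c => by
    have : ∑ a, w c * (G c * P a a + (∑ b, P a b * c b) * fderiv ℝ G c (Pi.single a 1)) =
        w c * G c * ∑ a, P a a +
          w c * ∑ a, (∑ b, P a b * c b) * fderiv ℝ G c (Pi.single a 1) := by
      rw [Finset.mul_sum, Finset.mul_sum, ← Finset.sum_add_distrib]
      exact Finset.sum_congr rfl fun a _ => by ring
    rw [this, hEuler c]
    ring
  have eR3 : ∀ c, ∑ a, θ c * c a * (G c * ∑ b, P a b * c b) =
      G c * θ c * ∑ a, c a * ∑ b, P a b * c b := fun c => by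
    rw [Finset.mul_sum]
    exact Finset.sum_congr rfl fun a _ => by ring
  have hC : (e + ∑ a, P a a) * ∫ c, G c * w c = -∫ c, G c * θ c * ∑ a, c a * ∑ b, P a b * c b := by
    simp_rw [dGP, eL3, hwd, eR3, integral_const_mul] at h3
    exact h3
  -- the pointwise inequality `-κ G θ ⟨Pc,c⟩ ≤ G θ ⟨c,Dc⟩`, integrated
  have hM : ∫ c, -κ * (G c * θ c * ∑ a, c a * ∑ b, P a b * c b) ≤
      ∫ c, G c * θ c * ∑ a, c a * ∑ b, D a b * c b := by
    refine integral_mono ((hint P).const_mul _) (hint D) fun c => ?_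
    have hc := hcoer c
    rw [inner, inner] at hc
    have hGθ : G c * θ c ≤ 0 := mul_nonpos_of_nonneg_of_nonpos (hnn c) (hθnp c)
    nlinarith [mul_nonneg (neg_nonneg.2 hGθ)
      (neg_nonneg.2 (by linarith : κ * (∑ a, c a * ∑ b, P a b * c b) +
        ∑ a, c a * ∑ b, D a b * c b ≤ 0))]
  rw [integral_const_mul] at hM
  -- conclusion: `(κ (e + tr P) + tr D) ∫ G w ≤ 0`, so `∫ G w = 0`, so `G w ≡ 0`
  have hI : (κ * (e + ∑ a, P a a) + ∑ a, D a a) * ∫ c, G c * w c ≤ 0 := by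
    linear_combination hM + κ * hC + hB
  have hI0 : ∫ c, G c * w c = 0 :=
    le_antisymm (nonpos_of_mul_nonpos_right hI hpos)
      (integral_nonneg fun c => mul_nonneg (hnn c) (hwnn c))
  have hae : (fun c => G c * w c) =ᵐ[volume] 0 :=
    (integral_eq_zero_iff_of_nonneg (fun c => mul_nonneg (hnn c) (hwnn c)) iGw).1 hI0
  have hzero : (fun c => G c * w c) = 0 :=
    (Continuous.ae_eq_iff_eq volume (hG.continuous.mul hwC.continuous) continuous_const).1 hae
  have h0 := congr_fun hzero c₀
  simp only [hw0, mul_one, Pi.zero_apply] at h0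
  exact h0

/-- **T-core — NO DISSIPATIVE TOWER, the finite-dimensional calculus step** (registered stub
`stub_noTowerCalculus` of the crux `QuarticLadder.QuarticGate`, line `dissipative-tower`).
On `ℝ^ι`: `V` a `C¹` drift, divergence free and tangent to spheres; `D`, `P` matrices with
`κ ∑ P a b cₐ c_b ≤ -∑ D a b cₐ c_b` (`κ > 0`); `h` a `C¹` observable, Euler-homogeneous of degree
`d ≥ 1` through `P` and a Casimir of `V`; `q` a `C¹` observable with the tower identity
`∑ₐ ∂ₐq Vₐ = ∑ₐ ∂ₐh (D c)ₐ`. Then `h ≡ 0`: `eq_zero_of_tower` applied to `G = h^{2m+2}`,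
`Q = (2m+2) h^{2m+1} q`, `e = (2m+2) d`, with `m` so large that `κ (e + tr P) + tr D > 0`.
[folklore-new] -/
theorem stub_noTowerCalculus :
    ∀ {ι : Type} [Fintype ι] [DecidableEq ι] (h q : (ι → ℝ) → ℝ) (V : ι → (ι → ℝ) → ℝ)
      (D P : ι → ι → ℝ) (κ : ℝ) (d : ℕ),
      ContDiff ℝ 1 h → ContDiff ℝ 1 q → (∀ a, ContDiff ℝ 1 (V a)) →
      (∀ c, ∑ a, fderiv ℝ (V a) c (Pi.single a 1) = 0) →
      (∀ c : ι → ℝ, ∑ a, c a * V a c = 0) →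
      0 < κ → 1 ≤ d →
      (∀ c : ι → ℝ, κ * ∑ a, ∑ b, P a b * c a * c b ≤ -∑ a, ∑ b, D a b * c a * c b) →
      (∀ c : ι → ℝ, ∑ a, (∑ b, P a b * c b) * fderiv ℝ h c (Pi.single a 1) = (d : ℝ) * h c) →
      (∀ c, ∑ a, fderiv ℝ h c (Pi.single a 1) * V a c = 0) →
      (∀ c : ι → ℝ, ∑ a, fderiv ℝ q c (Pi.single a 1) * V a c =
        ∑ a, fderiv ℝ h c (Pi.single a 1) * ∑ b, D a b * c b) →
      ∀ c, h c = 0 := by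
  intro ι _ _ h q V D P κ d hh hq hV hdiv htan hκ hd hcoer hEuler hCas htower c₀
  -- the exponent: `m` with `κ ((2m+2) d + tr P) + tr D > 0`
  obtain ⟨m, hm⟩ := exists_nat_gt (-(κ * ∑ a, P a a + ∑ a, D a a) / κ)
  have hm' : -(κ * ∑ a, P a a + ∑ a, D a a) < κ * m := by
    rw [div_lt_iff₀ hκ] at hm
    linarith
  have hd' : (1 : ℝ) ≤ d := by exact_mod_cast hd
  have hed : (m : ℝ) ≤ (2 * (m : ℝ) + 2) * d := by
    nlinarith [mul_nonneg (Nat.cast_nonneg (α := ℝ) m) (sub_nonneg.2 hd')]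
  have hpos : 0 < κ * ((2 * (m : ℝ) + 2) * d + ∑ a, P a a) + ∑ a, D a a := by
    nlinarith [mul_le_mul_of_nonneg_left hed hκ.le]
  -- derivatives of the powers of `h`
  have hhd : ∀ c, DifferentiableAt ℝ h c := fun c => hh.differentiable one_ne_zero c
  have hpow : ∀ (k : ℕ) (c : ι → ℝ) (a : ι), fderiv ℝ (fun c => h c ^ (k + 1)) c (Pi.single a 1) =
      ((k + 1 : ℕ) : ℝ) * h c ^ k * fderiv ℝ h c (Pi.single a 1) := by
    intro k c a
    rw [fderiv_fun_pow (k + 1) (hhd c), smul_apply, smul_eq_mul, nsmul_eq_mul,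
      add_tsub_cancel_right]
  have dQ : ∀ (c : ι → ℝ) (a : ι),
      fderiv ℝ (fun c => (2 * (m : ℝ) + 2) * h c ^ (2 * m + 1) * q c) c (Pi.single a 1) =
        (2 * (m : ℝ) + 2) * h c ^ (2 * m + 1) * fderiv ℝ q c (Pi.single a 1) +
          q c * ((2 * (m : ℝ) + 2) *
            (((2 * m + 1 : ℕ) : ℝ) * h c ^ (2 * m) * fderiv ℝ h c (Pi.single a 1))) := by
    intro c a
    rw [fderiv_fun_mul (((hhd c).fun_pow _).const_mul _) (hq.differentiable one_ne_zero c),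
      add_apply, smul_apply, smul_apply, smul_eq_mul, smul_eq_mul,
      fderiv_const_mul ((hhd c).fun_pow _), smul_apply, smul_eq_mul, hpow]
  have key := eq_zero_of_tower (G := fun c => h c ^ (2 * m + 1 + 1))
    (Q := fun c => (2 * (m : ℝ) + 2) * h c ^ (2 * m + 1) * q c) (V := V) (D := D) (P := P)
    (κ := κ) (e := (2 * (m : ℝ) + 2) * d) (hh.pow _)
    ((contDiff_const.mul (hh.pow _)).mul hq) hV hdiv htan hcoer ?_ ?_
    (fun c => Even.pow_nonneg (⟨m + 1, by ring⟩ : Even (2 * m + 1 + 1)) (h c)) hpos c₀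
  · exact (pow_eq_zero_iff (Nat.succ_ne_zero _)).1 key
  · -- Euler through `P`, degree `(2m+2) d`
    intro c
    simp_rw [hpow]
    have e1 : ∑ a, (∑ b, P a b * c b) *
        (((2 * m + 1 + 1 : ℕ) : ℝ) * h c ^ (2 * m + 1) * fderiv ℝ h c (Pi.single a 1)) =
        ((2 * m + 1 + 1 : ℕ) : ℝ) * h c ^ (2 * m + 1) *
          ∑ a, (∑ b, P a b * c b) * fderiv ℝ h c (Pi.single a 1) := by
      rw [Finset.mul_sum]
      exact Finset.sum_congr rfl fun a _ => by ring
    rw [e1, hEuler c]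
    push_cast
    ring
  · -- the tower identity for `(G, Q)` from the Casimir and tower identities for `(h, q)`
    intro c
    simp_rw [dQ, hpow]
    have e1 : ∑ a, ((2 * (m : ℝ) + 2) * h c ^ (2 * m + 1) * fderiv ℝ q c (Pi.single a 1) +
        q c * ((2 * (m : ℝ) + 2) *
          (((2 * m + 1 : ℕ) : ℝ) * h c ^ (2 * m) * fderiv ℝ h c (Pi.single a 1)))) * V a c =
        (2 * (m : ℝ) + 2) * h c ^ (2 * m + 1) * ∑ a, fderiv ℝ q c (Pi.single a 1) * V a c +
          q c * (2 * (m : ℝ) + 2) * ((2 * m + 1 : ℕ) : ℝ) * h c ^ (2 * m) *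
            ∑ a, fderiv ℝ h c (Pi.single a 1) * V a c := by
      rw [Finset.mul_sum, Finset.mul_sum, ← Finset.sum_add_distrib]
      exact Finset.sum_congr rfl fun a _ => by ring
    rw [e1, hCas c, htower c, mul_zero, add_zero, Finset.mul_sum]
    refine Finset.sum_congr rfl fun a _ => ?_
    push_cast
    ring

end Summit.AnomalousDissipation.AnomalousDissipation.Theorems.QuarticLadderQuarticGate
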